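import Summits.CriticalPhenomena.CardyFormulaZ2.Theses.CardySelfRefinement
import Summits.CriticalPhenomena.CardyFormulaZ2.Theorems.CardySelfRefinementLagHandOffMarkovKernel
import Summits.CriticalPhenomena.CardyFormulaZ2.Theorems.CardySelfRefinementLagHandOffKernelGluing
import Summits.CriticalPhenomena.CardyFormulaZ2.Theorems.CardySelfRefinementLagHandOffLimitCurveRegularity
import Literature.Probability.Percolation.QuadCrossingSpaceZ2
import HarnessLib

/-!
# The Markov property of the pinned limit family, reduced to a slit hand-off on approximating
# stopping sets: partial helper for stub `stub_limitMarkov` (R2′) of line `hitting-tournament`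
# for crux `LagHandOff` (stmt-CriticalPhenomena-10268)

The registered stub `stub_limitMarkov` says: the chordal family `P` PINNED by a subsequential
quad-crossing limit `μ` (interface laws of every admissible discretisation of every Dobrushin
domain converge to `P D` along every positive mesh sequence on which the full-plane quad laws
converge to `μ`) is domain Markov in the tree's set-based sense (`ChordalFamily.IsDomainMarkov`:
`∃ Q`, `initial ∧ markov-at-every-closed-F ∧ domain`).  It is conjecture-grade as a whole for
`ℤ²` subsequential limits (Smirnov ICM 2006 §4.2; Garban–Pete–Schramm 2013 p. 16: fractal slit
domains).  This file lands the REDUCTION of the stub to its genuine core, with everything else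
proved:

* `isProbabilityMeasure_of_pinned`, `ae_chordal_of_pinned` — a pinned family consists of
  probability laws carried by chordal curve classes of `(D; a, b)` (test function `1`; landed
  limit-curve regularity `stub_limitCurveRegularity_chordal`), given discretisability;
* `isDomainMarkov_of_slitHandOffApprox` — **the reduction, for ANY family `P` of probability
  laws of curves starting at `a`**: if a slit kernel `K (U; x, b)` (a probability law per
  slit-domain configuration: remaining open set, tip, target; Borel along pasts) disintegrates
  `P D`, for every closed `F`, at the members of SOME outer approximation `G₀ ⊇ G₁ ⊇ ⋯`,
  `⋂ G_k = F`, by closed sets, along which it is `P D`-a.s. weakly left-continuous, then `P` is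
  domain Markov.  Ingredients: kernel gluing (`markov_iInter_of_tendsto`,
  `…LagHandOffKernelGluing.lean`) gives `markov` at every closed `F`; `initial` FOLLOWS from
  `markov` at `F = {a}` (`initial_of_markov_singleton`); `domain` is the slit-kernel factorisation
  (`isDomainMarkov_iff_exists_slitKernel`).
* `stub_limitMarkov_of_core` — the registered reduction `H → (statement of stub_limitMarkov)`
  with the single residual hypothesis `H` = **slit hand-off on approximating stopping sets**
  for pinned families, stated inline.

About `H` (what remains, and its grade).  `H` is WEAKER in form than the conclusion's `markov`
clause (take `G_k := F`), up to the two technical side conditions (probability-valued,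
Borel-along-pasts kernel); its content is (i) the EXISTENCE and IDENTIFICATION of the limiting
interface law `K (U; x, b)` in the interface-lined slit configurations met along the exploration,
along the same mesh subsequence, at a class of stopping sets of the prover's choice (e.g. finite
unions of closed axis-parallel rectangles, where the lattice identities pass to the limit by the
line's no-touch results), and (ii) weak LEFT-CONTINUITY of `K` along growing pasts.  Both are
conjecture-grade for `ℤ²` subsequential limits (GPS13 p. 16; for the Camia–Newman limit on `𝕋`
they follow from conformal invariance of SLE₆); (ii) is the regularity without which
stopping-set consistency is not even a measure-theoretic statement (module docstring of
`…LagHandOffKernelGluing.lean`).  `H` CONTAINS the (ab)/(ba) wiring universality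
(`Negative/ArcSwap.lean`, `wiringSwap_sameLimit_of_isDomainMarkov`): `K` is indexed by the bare
remaining set, so `K (D; a, b) = P D = P D'` for the orientation-reversed twin `D'` — as it must,
since `IsDomainMarkov` alone forces it (`carrierDetermines_of_isDomainMarkov` in the skeleton); no
separate carrier clause is needed or useful.  Kernel gluing itself is NOT a hypothesis: it is the
theorem `stub_limitMarkov_kernelGluing`.

References: W. Werner, Lectures on two-dimensional critical percolation (2007) §3.2 (2);
O. Schramm, Israel J. Math. 118 (2000) §1; S. Smirnov, ICM 2006, §4.2; C. Garban, G. Pete,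
O. Schramm, J. Amer. Math. Soc. 26 (2013), p. 16.
-/

noncomputable section

open MeasureTheory ProbabilityTheory Filter Set Topology
open scoped BoundedContinuousFunction unitInterval ENNReal
open Literature.Probability.Percolation Literature.Probability.LatticeModels
open Literature.Probability.RandomPlanarGeometry Literature.Probability.Percolation.QuadCrossing
open Summit.CriticalPhenomena.CardyFormulaZ2.Theses.CardySelfRefinement

namespace Summit.CriticalPhenomena.CardyFormulaZ2.Cruxes.LagHandOff.HittingTournament

open Summit.CriticalPhenomena.CardyFormulaZ2.Cruxes.LagHandOff.CrosscutDictionary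

section Pinned

/-- **A pinned law is a probability law.** If the interface laws of an admissible discretisation
family converge weakly (against bounded continuous test functions) to the measure `ν`, then `ν`
is a probability measure (test function `1`; the percolation law is a probability law, and
`(ν univ).toReal = 1` excludes `ν univ = ∞`). [folklore] -/
theorem isProbabilityMeasure_of_tendsto_interface {D : DobrushinDomain} {E : ℝ → DiscreteDobrushin}
    {δs : ℕ → ℝ} {ν : Measure (CurveClass ℂ)}
    (hconv : ∀ f : CurveClass ℂ →ᵇ ℝ,
      Tendsto (fun n => ∫ ω, f (bondInterfaceIn D (E (δs n)) ω)
        ∂(bondPercolation (zdGraph 2) half)) atTop (𝓝 (∫ γ, f γ ∂ν))) :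
    IsProbabilityMeasure ν := by
  have h := hconv 1
  simp only [BoundedContinuousFunction.coe_one, Pi.one_apply, integral_const, smul_eq_mul,
    mul_one, probReal_univ] at h
  have h1 : ν.real univ = 1 := tendsto_nhds_unique h tendsto_const_nhds
  exact ⟨(ENNReal.toReal_eq_one_iff _).1 h1⟩

/-- **Pinned families are chordal probability laws.** For `μ` a subsequential quad-crossing limit
and `P` pinned by `μ`, if the Dobrushin domain `D` is discretisable then `P D` is a probability
measure carried by curve classes from `a = D.pt 0` to `b = D.pt 1` inside `closure D` (a mesh
sequence realising `μ`, `isSubseqQuadLimit_iff`; then the landed limit-curve regularity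
`stub_limitCurveRegularity_chordal`). [folklore] -/
theorem isProbabilityMeasure_and_ae_chordal_of_pinned
    {μ : FiniteMeasure (QuadConfig (Set.univ : Set ℂ))}
    (hμ : μ ∈ subseqQuadLimits (Set.univ : Set ℂ)) {P : ChordalFamily}
    (hpin : ∀ δs : ℕ → ℝ, (∀ n, 0 < δs n) → Tendsto δs atTop (𝓝 0) →
      Tendsto (fun n => z2QuadLaw (Set.univ : Set ℂ) (δs n)) atTop (𝓝 μ) →
      ∀ (D : DobrushinDomain) (E : ℝ → DiscreteDobrushin), ZdDiscretisationFamily D E →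
        ∀ f : CurveClass ℂ →ᵇ ℝ,
          Tendsto (fun n => ∫ ω, f (bondInterfaceIn D (E (δs n)) ω)
            ∂(bondPercolation (zdGraph 2) half)) atTop (𝓝 (∫ γ, f γ ∂(P D))))
    {D : DobrushinDomain} (hD : ∃ E : ℝ → DiscreteDobrushin, ZdDiscretisationFamily D E) :
    IsProbabilityMeasure (P D) ∧
      ∀ᵐ γ ∂(P D), γ.source = D.pt 0 ∧ γ.target = D.pt 1 ∧ γ.range ⊆ closure D.carrier := by
  obtain ⟨δs, hpos, hlim, hquad⟩ := (isSubseqQuadLimit_iff _ μ).1 hμ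
  obtain ⟨E, hE⟩ := hD
  have hconv := hpin δs hpos hlim hquad D E hE
  haveI : IsProbabilityMeasure (P D) := isProbabilityMeasure_of_tendsto_interface hconv
  exact ⟨inferInstance, stub_limitCurveRegularity_chordal D E hE δs hpos hlim (P D) hconv⟩

end Pinned

section Reduction

/-- **The domain Markov property from a slit hand-off on approximating stopping sets.**  Let `P`
be a family of probability laws on curve classes, `P D`-a.s. starting at `a = D.pt 0`, and let
`K (U; x, b)` be a slit kernel — a probability law for every slit-domain configuration (remaining
open set, tip, target), Borel along pasts `p ↦ K (remainingDomain D p; p.target, b)`.  Suppose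
that for every `D` and every closed `F` there are closed sets `G₀ ⊇ G₁ ⊇ ⋯` with `⋂ G_k = F` such
that `K` disintegrates `P D` along `(stopAt G_k, startFrom G_k)` for every `k` and is `P D`-a.s.
weakly left-continuous along the pasts `γ.stopAt G_k → γ.stopAt F`.  Then `P` is domain Markov
in the tree's set-based sense: kernel gluing (`markov_iInter_of_tendsto`) gives the `markov`
clause at every closed `F`; `initial` follows from `markov` at `F = {a}`
(`initial_of_markov_singleton`); `domain` is the slit-kernel factorisation
(`isDomainMarkov_iff_exists_slitKernel`). [folklore] -/
theorem isDomainMarkov_of_slitHandOffApprox (P : ChordalFamily)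
    (hprob : ∀ D : DobrushinDomain, IsProbabilityMeasure (P D))
    (hsrc : ∀ D : DobrushinDomain, ∀ᵐ γ ∂(P D), γ.source = D.pt 0)
    (K : Set ℂ → ℂ → ℂ → Measure (CurveClass ℂ)) (hKprob : ∀ U x b, IsProbabilityMeasure (K U x b))
    (hKm : ∀ (D : DobrushinDomain) (T : Set (CurveClass ℂ)), MeasurableSet T →
      Measurable fun p : CurveClass ℂ => K (remainingDomain D p) p.target (D.pt 1) T)
    (happrox : ∀ (D : DobrushinDomain) (F : Set ℂ), IsClosed F →
      ∃ G : ℕ → Set ℂ, (∀ k, IsClosed (G k)) ∧ Antitone G ∧ (⋂ k, G k) = F ∧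
        (∀ k, ∀ S T : Set (CurveClass ℂ), MeasurableSet S → MeasurableSet T →
          P D (CurveClass.stopAt (G k) ⁻¹' S ∩ CurveClass.startFrom (G k) ⁻¹' T) =
            ∫⁻ γ in CurveClass.stopAt (G k) ⁻¹' S,
              K (remainingDomain D (γ.stopAt (G k))) (γ.stopAt (G k)).target (D.pt 1) T ∂(P D)) ∧
        ∀ g : CurveClass ℂ →ᵇ ℝ, ∀ᵐ γ ∂(P D),
          Tendsto (fun k => ∫ x, g x
            ∂(K (remainingDomain D (γ.stopAt (G k))) (γ.stopAt (G k)).target (D.pt 1))) atTop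
            (𝓝 (∫ x, g x ∂(K (remainingDomain D (γ.stopAt F)) (γ.stopAt F).target (D.pt 1))))) :
    P.IsDomainMarkov := by
  -- `markov` at every closed `F`, by kernel gluing along the given outer approximation
  have hmarkov : ∀ (D : DobrushinDomain) (F : Set ℂ), IsClosed F →
      ∀ S T : Set (CurveClass ℂ), MeasurableSet S → MeasurableSet T →
        P D (CurveClass.stopAt F ⁻¹' S ∩ CurveClass.startFrom F ⁻¹' T) =
          ∫⁻ γ in CurveClass.stopAt F ⁻¹' S,
            K (remainingDomain D (γ.stopAt F)) (γ.stopAt F).target (D.pt 1) T ∂(P D) := by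
    intro D F hF
    obtain ⟨G, hG, hanti, hGF, hmk, hcont⟩ := happrox D F hF
    subst hGF
    exact markov_iInter_of_tendsto (P D) (fun p => K (remainingDomain D p) p.target (D.pt 1))
      (fun p => hKprob _ _ _) (hKm D) hG hanti hmk hcont
  refine (isDomainMarkov_iff_exists_slitKernel P).2 ⟨K, fun D => ?_, hmarkov⟩
  -- `initial` from `markov` at `F = {a}`
  have h := initial_of_markov_singleton (P := P D) (hsrc D)
    (Q := fun p => K (remainingDomain D p) p.target (D.pt 1)) (hmarkov D {D.pt 0} isClosed_singleton)
  have ha : (Curve.const (D.pt 0)).target = D.pt 0 := rfl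
  rwa [remainingDomain_mk_const, CurveClass.target_mk, ha] at h

/-- **Registered reduction `stub_limitMarkov_of_core` of `stub_limitMarkov` (R2′).**  The stub
follows from ONE residual hypothesis, the **slit hand-off on approximating stopping sets** for
pinned families: for every subsequential quad limit `μ`, every family `P` pinned by `μ` and
discretisability of every Dobrushin domain, there is a slit kernel `K (U; x, b)` (probability
laws, Borel along pasts) which, for every `D` and every closed `F`, disintegrates `P D` at the
members of SOME outer approximation of `F` by closed sets (the class is the prover's choice) and
is `P D`-a.s. weakly left-continuous along it.  Grade: the hand-off (existence + identification
of the interface limit in lined slit configurations along the same meshes) and the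
left-continuity are conjecture-grade for `ℤ²` sublimits (GPS13 p. 16; Smirnov ICM 2006 §4.2);
everything else — chordality of pinned laws, kernel gluing to all closed `F`, `initial`,
`domain`, and the wiring universality it contains — is proved here and in
`…LagHandOffKernelGluing.lean` / `…LagHandOffMarkovKernel.lean`. [folklore] -/
theorem stub_limitMarkov_of_core : (∀ μ ∈ subseqQuadLimits (Set.univ : Set ℂ), ∀ P : ChordalFamily, (∀ δs : ℕ → ℝ, (∀ n, 0 < δs n) → Tendsto δs atTop (𝓝 0) → Tendsto (fun n => z2QuadLaw (Set.univ : Set ℂ) (δs n)) atTop (𝓝 μ) → ∀ (D : DobrushinDomain) (E : ℝ → DiscreteDobrushin), ZdDiscretisationFamily D E → ∀ f : CurveClass ℂ →ᵇ ℝ, Tendsto (fun n => ∫ ω, f (bondInterfaceIn D (E (δs n)) ω) ∂(bondPercolation (zdGraph 2) half)) atTop (𝓝 (∫ γ, f γ ∂(P D)))) → (∀ D : DobrushinDomain, ∃ E : ℝ → DiscreteDobrushin, ZdDiscretisationFamily D E) → ∃ K : Set ℂ → ℂ → ℂ → Measure (CurveClass ℂ), (∀ U x b, IsProbabilityMeasure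 (K U x b)) ∧ (∀ (D : DobrushinDomain) (T : Set (CurveClass ℂ)), MeasurableSet T → Measurable fun p : CurveClass ℂ => K (remainingDomain D p) p.target (D.pt 1) T) ∧ ∀ (D : DobrushinDomain) (F : Set ℂ), IsClosed F → ∃ G : ℕ → Set ℂ, (∀ k, IsClosed (G k)) ∧ Antitone G ∧ (⋂ k, G k) = F ∧ (∀ k, ∀ S T : Set (CurveClass ℂ), MeasurableSet S → MeasurableSet T → P D (CurveClass.stopAt (G k) ⁻¹' S ∩ CurveClass.startFrom (G k) ⁻¹' T) = ∫⁻ γ in CurveClass.stopAt (G k) ⁻¹' S, K (remainingDomain D (γ.stopAt (G k))) (γ.stopAt (G k)).target (D.pt 1) T ∂(P D)) ∧ ∀ g : CurveClass ℂ →ᵇ ℝ, ∀ᵐ γ ∂(P D), Tendsto (fun k => ∫ x, g x ∂(K (remainingDomain D (γ.stopAt (G k))) (γ.stopAt (G k)).target (D.pt 1))) atTop (𝓝 (∫ x, g x ∂(K (remainingDomain D (γ.stopAt F)) (γ.stopAt F).target (D.pt 1))))) → ∀ μ ∈ subseqQuadLimits (Set.univ : Set ℂ), ∀ P : ChordalFamily,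 (∀ δs : ℕ → ℝ, (∀ n, 0 < δs n) → Tendsto δs atTop (𝓝 0) → Tendsto (fun n => z2QuadLaw (Set.univ : Set ℂ) (δs n)) atTop (𝓝 μ) → ∀ (D : DobrushinDomain) (E : ℝ → DiscreteDobrushin), ZdDiscretisationFamily D E → ∀ f : CurveClass ℂ →ᵇ ℝ, Tendsto (fun n => ∫ ω, f (bondInterfaceIn D (E (δs n)) ω) ∂(bondPercolation (zdGraph 2) half)) atTop (𝓝 (∫ γ, f γ ∂(P D)))) → (∀ D : DobrushinDomain, ∃ E : ℝ → DiscreteDobrushin, ZdDiscretisationFamily D E) → P.IsDomainMarkov := by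
  intro hcore μ hμ P hpin hdisc
  obtain ⟨K, hKprob, hKm, happrox⟩ := hcore μ hμ P hpin hdisc
  have hreg := fun D : DobrushinDomain =>
    isProbabilityMeasure_and_ae_chordal_of_pinned hμ hpin (hdisc D)
  exact isDomainMarkov_of_slitHandOffApprox P (fun D => (hreg D).1)
    (fun D => ((hreg D).2).mono fun γ hγ => hγ.1) K hKprob hKm happrox

end Reduction

end Summit.CriticalPhenomena.CardyFormulaZ2.Cruxes.LagHandOff.HittingTournament

end
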